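import Mathlib
import Literature.NumberTheory.LFunctions.WeilTwoPrimeOddMarginFCert
import Literature.NumberTheory.LFunctions.WeilTwoPrimeQuadratic
import Summits.RiemannHypothesis.RiemannHypothesis.Theses.WeilGroundState
import HarnessLib

/-!
# Crux `GroundStateSimpleEven` (stmt-RiemannHypothesis-1526), line `parity-multiplicity-commutator` (v7):
# stub `stub_oddLowerF` — the certified odd-sector bound at window `63/100`

Support file (`--supports stmt-RiemannHypothesis-1526`) proving the registered stub `stub_oddLowerF`: every
`L²`-normalised ODD Weil test function supported in `[-63/100, 63/100]` has `Re Q(g) ≥ 3/100000000` — the L-side of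
cell F of the skeleton v7.  It is the kernel-checked two-prime odd-sector MARGIN certificate
`weilCert23F` (`Literature/NumberTheory/LFunctions/WeilTwoPrimeOddMarginF*.lean`: Yoshida's moment method
[Yoshida 1992, Thm 1] in the two-prime analytic form `E₂₃` with 248 certified cells of the weight
`Re ψ(1/4+it/2) − √2 log 2 cos(t log 2) − (2 log 3/√3) cos(t log 3)` on `[0, 80]`, `N = 157`, odd block at the
lowered Bessel coefficient `κ' = κ − 3/100000000`; soundness `WeilCert23.weilTwoPrimeQuadratic_margin_of_parts`), transported
to `Re Q` by `weilQuadratic_re_eq_weilTwoPrimeQuadratic` (`63/100 ≤ log 2`).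
-/

noncomputable section

open Set MeasureTheory

namespace Summit.RiemannHypothesis.RiemannHypothesis.Theorems

open Literature.NumberTheory.LFunctions

/-- **Registered stub `stub_oddLowerF` of line `parity-multiplicity-commutator` (v7)**: every `L²`-normalised odd
Weil test function on `[-63/100, 63/100]` has `Re Q ≥ 3/100000000` (two-prime odd-sector margin certificate F). [folklore] -/
theorem stub_oddLowerF : ∀ g : ℝ → ℂ, IsWeilTest g → tsupport g ⊆ Icc (-(63 / 100 : ℝ)) (63 / 100) → ∫ x, ‖g x‖ ^ 2 = (1 : ℝ) → (∀ x, g (-x) = -g x) → (3 / 100000000 : ℝ) ≤ (weilQuadratic g).re := by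
  intro g hg hs hn ho
  have hl2 := Real.log_two_gt_d9
  have hs2 : tsupport g ⊆ Icc (-Real.log 2) (Real.log 2) :=
    hs.trans (Icc_subset_Icc (by norm_num at hl2 ⊢; linarith) (by norm_num at hl2 ⊢; linarith))
  have h := oddMargin_weilCert23F hg hs ho
  rw [weilQuadratic_re_eq_weilTwoPrimeQuadratic hg hs2]
  have hn' : weilNorm2Sq g = 1 := hn
  rw [hn', mul_one] at h
  exact h

end Summit.RiemannHypothesis.RiemannHypothesis.Theorems
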